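import Literature.NumberTheory.EllipticCurves.HeathBrown1994.CongruentTwoSelmerMonskyMatrix
import Mathlib.NumberTheory.LegendreSymbol.JacobiSymbol
import Mathlib.Data.Matrix.Block
import Mathlib.Algebra.CharP.Two
import HarnessLib

/-!
# Route `PrintCf2`, crux stmt-BirchSwinnertonDyer-20509 `RamifiedOffTYZOfFacts` — Monsky's matrix in RÉDEI FORM
# (cell `bsd-print-cf2`, LEAD of 20509 g5, line `offtyz-v7`, lineage cycle 6; Theses-free, fact-free, no `def`)

HONEST FRAMING (crux 20509 DECIDING, OPEN AS A CLASS). This file proves 𝔽₂-linear-algebra BOOKKEEPING about the tree's Monsky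
matrix `M_n = ( A+D₂ D₂ ; D₂ A+D₋₂ )` (`HeathBrown1994.monskyMatrixOdd`, appendix to Heath-Brown 1994) for `n = p₁⋯p_k` odd
square-free — nothing about `E_n`, Selmer groups or BSD is asserted. It is the kernel side of the LEAD note
`Cruxes/RamifiedOffTYZOfFacts/Lines/offtyz_v7_QForm.md` §4 and of the typed conjecture `Lines/offtyz_v7_QForm.lean` (the Q-form identity
(★): the H²(Gal(L_n(i)/ℚ), 𝔽₂)-invariant of Tian–Yuan–Zhang's genus point equals `q(κ_n)`, `κ_n = Σ_{v ∈ ker M_n} v`):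

* §1 `legendreMatrix_mulVec_one`: `A·𝟙 = 0` (row sums vanish; so `corank A ≥ 1` always — the lift of `𝔭₂` has order 4 in `Pic(O₂)`).
* §2 quadratic reciprocity in additive form: `(p_j/p_i)_+ = (p_i/p_j)_+ + (−1/p_i)_+(−1/p_j)_+` (`addLegendreSym_swap`), and
  `(−2/p)_+ = (−1/p)_+ + (2/p)_+` (`addLegendreSym_neg_two`); hence **`Aᵀ = A + D₋₁ + c₋₁c₋₁ᵀ`** (`legendreMatrix_transpose`):
  `N := A + D₋₁` (the Rédei matrix of the REAL field `ℚ(√n)`, same off-diagonal as `A` = Rédei matrix of `ℚ(√−n)`) differs from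
  `Aᵀ` by the rank-one matrix of the primes `≡ 3 (mod 4)`.
* §3 **the Rédei form of the kernel**: `M_n (a; b) = 0 ⟺ A a = D₂(a+b) ∧ (A + D₋₁) b = D₂(a+b)` (`monskyMatrixOdd_mulVec_eq_zero_iff`).
* §4 for `n ≡ 5 (mod 8)` some `p_i ≡ ±3 (mod 8)` (`exists_addLegendreSym_two_eq_one_of_prod_mod_eight`), so `M_n(𝟙; 0) = (c₂; c₂) ≠ 0`
  and **every non-zero kernel vector `(a; b)` has `b ≠ 0` or `a` non-constant** (`kernel_nondegenerate_of_prod_mod_eight`) — i.e.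
  `q(a;b) = x_a x_{n/a} + x_b x_{−n/b} ≠ 0`: the step «(★) ∧ s(n) = 1 ⟹ Q_n ≠ 0 ⟹ Galois mover» of the note, whose door is
  `GaloisMotion.rankOne_sha_bsdp_two_congruentNumberCurve_of_selmerEight_of_mover` (p672160).

Beyond-print theorem: NO (linear algebra over `ZMod 2`). BSD is not proved by any of this; no class is closed by this file.

References: [cite: HeathBrown1994SelmerCongruentII, Appendix (Monsky), typescript p. 39 L10–L33]; Mathlib
`jacobiSym.quadratic_reciprocity_one_mod_four`, `…_three_mod_four`, `jacobiSym.at_neg_one/at_two/at_neg_two`, `ZMod.χ₄/χ₈/χ₈'`.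
-/

namespace Summit.BirchSwinnertonDyer.PrintCf2.MonskyRedeiForm

open Finset Matrix Literature.NumberTheory.EllipticCurves.HeathBrown1994

variable {k : ℕ} (p : Fin k → ℕ)

/-! ## §0 `ZMod 2` helpers -/

/-- The additive symbol takes the value `0` or `1` according to the Jacobi symbol being `1` or not. [folklore] -/
theorem addLegendreSym_eq_one_iff (a : ℤ) (q : ℕ) : addLegendreSym a q = 1 ↔ jacobiSym a q ≠ 1 := by
  unfold addLegendreSym
  split_ifs with h
  · simp [h]
  · simp [h]

/-- The additive symbol vanishes iff the Jacobi symbol is `1`. [folklore] -/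
theorem addLegendreSym_eq_zero_iff (a : ℤ) (q : ℕ) : addLegendreSym a q = 0 ↔ jacobiSym a q = 1 := by
  unfold addLegendreSym
  split_ifs with h
  · simp [h]
  · simp [h]

/-! ## §1 Row sums of `A` vanish -/

/-- **`A·𝟙 = 0`**: the row sums of Monsky's `A` vanish (the diagonal entry is the sum of the off-diagonal entries of its row), so the
all-ones vector (the principal class / the relation `∏ 𝔭_p = (√−n)`) is always in the right kernel and `corank A ≥ 1`.
[cite: HeathBrown1994SelmerCongruentII, Appendix (Monsky), typescript p. 39 L13–L26] -/
theorem legendreMatrix_mulVec_one : legendreMatrix p *ᵥ (fun _ => (1 : ZMod 2)) = 0 := by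
  ext i
  simp only [mulVec, dotProduct, mul_one, Pi.zero_apply]
  rw [← Finset.add_sum_erase _ _ (Finset.mem_univ i)]
  have hdiag : legendreMatrix p i i = ∑ l ∈ Finset.univ.erase i, addLegendreSym (p l) (p i) := by
    simp [legendreMatrix]
  have hoff : ∑ j ∈ Finset.univ.erase i, legendreMatrix p i j =
      ∑ l ∈ Finset.univ.erase i, addLegendreSym (p l) (p i) := by
    refine Finset.sum_congr rfl fun j hj => ?_
    have hij : i ≠ j := (Finset.ne_of_mem_erase hj).symm
    simp [legendreMatrix, hij]
  rw [hdiag, hoff, CharTwo.add_self_eq_zero]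

/-! ## §2 Quadratic reciprocity, additively; the transpose law -/

section QR

variable {q r : ℕ}

/-- `(−1/q)_+ = 1 ⟺ q ≡ 3 (mod 4)` for odd `q`. [folklore] -/
theorem addLegendreSym_neg_one_eq_one_iff (hq : Odd q) : addLegendreSym (-1) q = 1 ↔ q % 4 = 3 := by
  rw [addLegendreSym_eq_one_iff, jacobiSym.at_neg_one hq, ZMod.χ₄_nat_eq_if_mod_four]
  have h2 : q % 2 = 1 := Nat.odd_iff.mp hq
  rcases Nat.odd_mod_four_iff.mp h2 with h | h <;> simp [h, h2]

/-- `(−1/q)_+ = 0 ⟺ q ≡ 1 (mod 4)` for odd `q`. [folklore] -/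
theorem addLegendreSym_neg_one_eq_zero_iff (hq : Odd q) : addLegendreSym (-1) q = 0 ↔ q % 4 = 1 := by
  rw [addLegendreSym_eq_zero_iff, jacobiSym.at_neg_one hq, ZMod.χ₄_nat_eq_if_mod_four]
  have h2 : q % 2 = 1 := Nat.odd_iff.mp hq
  rcases Nat.odd_mod_four_iff.mp h2 with h | h <;> simp [h, h2]

/-- `(2/q)_+ = 1 ⟺ q ≡ ±3 (mod 8)` for odd `q`. [folklore] -/
theorem addLegendreSym_two_eq_one_iff (hq : Odd q) : addLegendreSym 2 q = 1 ↔ (q % 8 = 3 ∨ q % 8 = 5) := by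
  rw [addLegendreSym_eq_one_iff, jacobiSym.at_two hq, ZMod.χ₈_nat_eq_if_mod_eight]
  have h2 : q % 2 = 1 := Nat.odd_iff.mp hq
  have h8 : q % 8 = 1 ∨ q % 8 = 3 ∨ q % 8 = 5 ∨ q % 8 = 7 := by omega
  rcases h8 with h | h | h | h <;> simp [h, h2]

/-- **`(−2/q)_+ = (−1/q)_+ + (2/q)_+`** for odd `q` (multiplicativity of the Jacobi symbol, additively). [folklore] -/
theorem addLegendreSym_neg_two (hq : Odd q) : addLegendreSym (-2) q = addLegendreSym (-1) q + addLegendreSym 2 q := by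
  have h2 : q % 2 = 1 := Nat.odd_iff.mp hq
  have h8 : q % 8 = 1 ∨ q % 8 = 3 ∨ q % 8 = 5 ∨ q % 8 = 7 := by omega
  have e1 : addLegendreSym (-2) q = if q % 8 = 1 ∨ q % 8 = 3 then 0 else 1 := by
    unfold addLegendreSym
    rw [jacobiSym.at_neg_two hq, ZMod.χ₈'_nat_eq_if_mod_eight]
    rcases h8 with h | h | h | h <;> simp [h, h2]
  have e2 : addLegendreSym (-1) q = if q % 4 = 1 then 0 else 1 := by
    unfold addLegendreSym
    rw [jacobiSym.at_neg_one hq, ZMod.χ₄_nat_eq_if_mod_four]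
    rcases Nat.odd_mod_four_iff.mp h2 with h | h <;> simp [h, h2]
  have e3 : addLegendreSym 2 q = if q % 8 = 1 ∨ q % 8 = 7 then 0 else 1 := by
    unfold addLegendreSym
    rw [jacobiSym.at_two hq, ZMod.χ₈_nat_eq_if_mod_eight]
    rcases h8 with h | h | h | h <;> simp [h, h2]
  rw [e1, e2, e3]
  rcases h8 with h | h | h | h
  · have h4 : q % 4 = 1 := by omega
    simp [h, h4]
  · have h4 : q % 4 = 3 := by omega
    simp only [h, h4]; decide
  · have h4 : q % 4 = 1 := by omega
    simp [h, h4]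
  · have h4 : q % 4 = 3 := by omega
    simp only [h, h4]; decide

/-- **Quadratic reciprocity, additively**: for distinct odd primes `q, r`,
`(r/q)_+ = (q/r)_+ + (−1/q)_+·(−1/r)_+`. [folklore] -/
theorem addLegendreSym_swap (hq : q.Prime) (hr : r.Prime) (hq2 : q ≠ 2) (hr2 : r ≠ 2) (hqr : q ≠ r) :
    addLegendreSym r q = addLegendreSym q r + addLegendreSym (-1) q * addLegendreSym (-1) r := by
  have hqo : Odd q := hq.odd_of_ne_two hq2
  have hro : Odd r := hr.odd_of_ne_two hr2
  have hq1 : q % 2 = 1 := Nat.odd_iff.mp hqo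
  have hr1 : r % 2 = 1 := Nat.odd_iff.mp hro
  -- the Jacobi symbols are ±1 (coprime)
  have hcop : (r : ℤ).gcd q = 1 := by
    rw [Int.gcd_natCast_natCast]
    exact (Nat.coprime_primes hr hq).mpr (Ne.symm hqr)
  have hcop' : (q : ℤ).gcd r = 1 := by
    rw [Int.gcd_natCast_natCast]
    exact (Nat.coprime_primes hq hr).mpr hqr
  rcases Nat.odd_mod_four_iff.mp hq1 with hq4 | hq4
  · -- q ≡ 1 (mod 4): symmetric, and (−1/q)_+ = 0
    have hsym : jacobiSym (r : ℤ) q = jacobiSym (q : ℤ) r :=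
      (jacobiSym.quadratic_reciprocity_one_mod_four' hro hq4)
    have h0 : addLegendreSym (-1) q = 0 := (addLegendreSym_neg_one_eq_zero_iff hqo).mpr hq4
    rw [h0, zero_mul, add_zero]
    unfold addLegendreSym
    rw [hsym]
  · rcases Nat.odd_mod_four_iff.mp hr1 with hr4 | hr4
    · have hsym : jacobiSym (r : ℤ) q = jacobiSym (q : ℤ) r :=
        jacobiSym.quadratic_reciprocity_one_mod_four hr4 hqo
      have h0 : addLegendreSym (-1) r = 0 := (addLegendreSym_neg_one_eq_zero_iff hro).mpr hr4
      rw [h0, mul_zero, add_zero]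
      unfold addLegendreSym
      rw [hsym]
    · -- both ≡ 3 (mod 4): antisymmetric
      have hanti : jacobiSym (r : ℤ) q = -jacobiSym (q : ℤ) r :=
        jacobiSym.quadratic_reciprocity_three_mod_four hr4 hq4
      have h1q : addLegendreSym (-1) q = 1 := (addLegendreSym_neg_one_eq_one_iff hqo).mpr hq4
      have h1r : addLegendreSym (-1) r = 1 := (addLegendreSym_neg_one_eq_one_iff hro).mpr hr4
      rw [h1q, h1r, mul_one]
      unfold addLegendreSym
      rw [hanti]
      rcases jacobiSym.eq_one_or_neg_one hcop' with h | h
      · simp [h]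
      · simp only [h, neg_neg]; decide

end QR

variable (hp : ∀ i, (p i).Prime) (hp2 : ∀ i, p i ≠ 2) (hinj : Function.Injective p)

include hp hp2 hinj in
/-- **The transpose law `Aᵀ = A + D₋₁ + c₋₁c₋₁ᵀ`** (`c₋₁ = ((−1/p_i)_+)_i`): off the diagonal this is quadratic reciprocity, on the
diagonal `c_i + c_i² = 0`. Consequently `N := A + D₋₁` (the Rédei matrix of `ℚ(√n)`: same off-diagonal entries, diagonal fixed by the
relation `∏ χ_{p_i} = 1`) equals `Aᵀ + c₋₁c₋₁ᵀ`. [cite: HeathBrown1994SelmerCongruentII, Appendix (Monsky), typescript p. 39 L13–L26] -/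
theorem legendreMatrix_transpose :
    (legendreMatrix p)ᵀ = legendreMatrix p + legendreDiagonal p (-1) +
      Matrix.of (fun i j => addLegendreSym (-1) (p i) * addLegendreSym (-1) (p j)) := by
  ext i j
  rw [Matrix.transpose_apply, Matrix.add_apply, Matrix.add_apply, Matrix.of_apply]
  unfold legendreDiagonal
  by_cases hij : i = j
  · subst hij
    have hsq : ∀ x : ZMod 2, x * x = x := by decide
    rw [Matrix.diagonal_apply_eq, hsq, add_assoc, CharTwo.add_self_eq_zero, add_zero]
  · have hji : j ≠ i := fun h => hij h.symm
    rw [Matrix.diagonal_apply_ne _ hij, add_zero]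
    simp only [legendreMatrix, Matrix.of_apply, if_neg hji, if_neg hij]
    rw [addLegendreSym_swap (hp i) (hp j) (hp2 i) (hp2 j) (fun h => hij (hinj h)), add_assoc, CharTwo.add_self_eq_zero,
      add_zero]

include hp hp2 in
/-- `D₋₂ = D₋₁ + D₂` for odd primes. [cite: HeathBrown1994SelmerCongruentII, Appendix (Monsky), typescript p. 39 L10–L13] -/
theorem legendreDiagonal_neg_two :
    legendreDiagonal p (-2) = legendreDiagonal p (-1) + legendreDiagonal p 2 := by
  unfold legendreDiagonal
  rw [diagonal_add]
  congr 1
  ext i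
  exact addLegendreSym_neg_two ((hp i).odd_of_ne_two (hp2 i))

/-! ## §3 The Rédei form of the kernel of `M_n` -/

/-- `Sum.elim u v = 0 ⟺ u = 0 ∧ v = 0`. [folklore] -/
theorem sumElim_eq_zero_iff {α : Type*} [Zero α] (u v : Fin k → α) : Sum.elim u v = 0 ↔ u = 0 ∧ v = 0 := by
  constructor
  · intro h
    refine ⟨funext fun i => ?_, funext fun i => ?_⟩
    · exact congrFun h (Sum.inl i)
    · exact congrFun h (Sum.inr i)
  · rintro ⟨hu, hv⟩
    funext x
    cases x with
    | inl i => simp [hu]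
    | inr i => simp [hv]

/-- Over `ℤ/2`: `u + w = 0 ⟺ u = w` (vectors). [folklore] -/
theorem vec_add_eq_zero_iff (u w : Fin k → ZMod 2) : u + w = 0 ↔ u = w := by
  rw [add_eq_zero_iff_eq_neg]
  have : -w = w := funext fun i => ZMod.neg_eq_self_mod_two (w i)
  rw [this]

include hp hp2 in
/-- **Rédei form of Monsky's kernel.** For `v = (a; b)`:
`M_n v = 0 ⟺ A a = D₂(a + b) ∧ (A + D₋₁) b = D₂(a + b)` — the imaginary Rédei matrix `A` on the `x+n` class `a`, the real one
`N = A + D₋₁` on the `x` class `b`, both equal to the 2-adic vector `D₂(a+b)` supported on the primes `≡ ±3 (mod 8)` of `a·b`.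
[cite: HeathBrown1994SelmerCongruentII, Appendix (Monsky), typescript p. 39 L27–L33] -/
theorem monskyMatrixOdd_mulVec_eq_zero_iff (a b : Fin k → ZMod 2) :
    monskyMatrixOdd p *ᵥ Sum.elim a b = 0 ↔
      legendreMatrix p *ᵥ a = legendreDiagonal p 2 *ᵥ (a + b) ∧
        (legendreMatrix p + legendreDiagonal p (-1)) *ᵥ b = legendreDiagonal p 2 *ᵥ (a + b) := by
  have hsplit : monskyMatrixOdd p *ᵥ Sum.elim a b =
      Sum.elim ((legendreMatrix p + legendreDiagonal p 2) *ᵥ a + legendreDiagonal p 2 *ᵥ b)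
        (legendreDiagonal p 2 *ᵥ a + (legendreMatrix p + legendreDiagonal p (-2)) *ᵥ b) := by
    unfold monskyMatrixOdd
    rw [fromBlocks_mulVec]
    rfl
  rw [hsplit, sumElim_eq_zero_iff, legendreDiagonal_neg_two p hp hp2]
  have e1 : (legendreMatrix p + legendreDiagonal p 2) *ᵥ a + legendreDiagonal p 2 *ᵥ b =
      legendreMatrix p *ᵥ a + legendreDiagonal p 2 *ᵥ (a + b) := by
    rw [add_mulVec, mulVec_add]; abel
  have e2 : legendreDiagonal p 2 *ᵥ a + (legendreMatrix p + (legendreDiagonal p (-1) + legendreDiagonal p 2)) *ᵥ b =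
      (legendreMatrix p + legendreDiagonal p (-1)) *ᵥ b + legendreDiagonal p 2 *ᵥ (a + b) := by
    rw [add_mulVec, add_mulVec, add_mulVec, mulVec_add]; abel
  rw [e1, e2, vec_add_eq_zero_iff, vec_add_eq_zero_iff]

/-! ## §4 `n ≡ 5 (mod 8)`: the kernel is non-degenerate for `q` -/

/-- A product of integers each `≡ ±1 (mod 8)` is `≡ ±1 (mod 8)`. [folklore] -/
theorem prod_mod_eight_of_forall (s : Finset (Fin k)) (h : ∀ i ∈ s, p i % 8 = 1 ∨ p i % 8 = 7) :
    (∏ i ∈ s, p i) % 8 = 1 ∨ (∏ i ∈ s, p i) % 8 = 7 := by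
  induction s using Finset.induction_on with
  | empty => simp
  | insert j s hj ih =>
    rw [Finset.prod_insert hj, Nat.mul_mod]
    have hjv := h j (Finset.mem_insert_self j s)
    have hsv := ih fun i hi => h i (Finset.mem_insert_of_mem hi)
    rcases hjv with hj1 | hj7 <;> rcases hsv with hs1 | hs7
    · left; rw [hj1, hs1]
    · right; rw [hj1, hs7]
    · right; rw [hj7, hs1]
    · left; rw [hj7, hs7]

include hp hp2 in
/-- **For `n = ∏ p_i ≡ 5 (mod 8)` some `p_i ≡ ±3 (mod 8)`**, i.e. `(2/p_i)_+ = 1`: the vector `c₂ = D₂·𝟙` is non-zero.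
[folklore] -/
theorem exists_addLegendreSym_two_eq_one_of_prod_mod_eight (h5 : (∏ i, p i) % 8 = 5) :
    ∃ i, addLegendreSym 2 (p i) = 1 := by
  by_contra hne
  push Not at hne
  have hall : ∀ i ∈ (Finset.univ : Finset (Fin k)), p i % 8 = 1 ∨ p i % 8 = 7 := by
    intro i _
    have hodd : Odd (p i) := (hp i).odd_of_ne_two (hp2 i)
    have h8 : p i % 8 = 1 ∨ p i % 8 = 3 ∨ p i % 8 = 5 ∨ p i % 8 = 7 := by
      have := Nat.odd_iff.mp hodd; omega
    rcases h8 with h | h | h | h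
    · exact Or.inl h
    · exact absurd ((addLegendreSym_two_eq_one_iff hodd).mpr (Or.inl h)) (hne i)
    · exact absurd ((addLegendreSym_two_eq_one_iff hodd).mpr (Or.inr h)) (hne i)
    · exact Or.inr h
  rcases prod_mod_eight_of_forall p Finset.univ hall with h | h <;> omega

include hp hp2 in
/-- **`M_n(𝟙; 0) ≠ 0` for `n ≡ 5 (mod 8)`**: the vector `(a; b) = (n; 1)` (all of `a`, none of `b`) is not in Monsky's kernel, since
`M_n(𝟙;0) = (D₂𝟙; D₂𝟙) = (c₂; c₂)` and `c₂ ≠ 0`. [cite: HeathBrown1994SelmerCongruentII, Appendix (Monsky), typescript p. 39 L27–L33] -/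
theorem monskyMatrixOdd_mulVec_one_zero_ne_zero (h5 : (∏ i, p i) % 8 = 5) :
    monskyMatrixOdd p *ᵥ Sum.elim (fun _ => (1 : ZMod 2)) 0 ≠ 0 := by
  intro h0
  rw [monskyMatrixOdd_mulVec_eq_zero_iff p hp hp2] at h0
  obtain ⟨h1, -⟩ := h0
  rw [legendreMatrix_mulVec_one, add_zero] at h1
  obtain ⟨i, hi⟩ := exists_addLegendreSym_two_eq_one_of_prod_mod_eight p hp hp2 h5
  have := congrFun h1 i
  rw [Pi.zero_apply] at this
  unfold legendreDiagonal at this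
  rw [mulVec_diagonal, hi, one_mul] at this
  exact zero_ne_one this

include hp hp2 in
/-- **Non-degeneracy of the kernel for `q` (`n ≡ 5 (mod 8)`).** Every NON-ZERO kernel vector `(a; b)` of `M_n` has `b ≠ 0` or `a`
non-constant — i.e. the linear form `q(a;b) = x_a·x_{n/a} + x_b·x_{−n/b}` of the LEAD note does not vanish on it (it vanishes exactly
on `(0;0)` and `(𝟙;0)`). So (★) `Q_n = q(κ_n)` and `s(n) = 1` give `Q_n ≠ 0`, a Galois mover, and the door p672160.
[cite: HeathBrown1994SelmerCongruentII, Appendix (Monsky), typescript p. 39 L27–L33] -/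
theorem kernel_nondegenerate_of_prod_mod_eight (h5 : (∏ i, p i) % 8 = 5) (a b : Fin k → ZMod 2)
    (hker : monskyMatrixOdd p *ᵥ Sum.elim a b = 0) (hne : Sum.elim a b ≠ 0) :
    b ≠ 0 ∨ ∃ i j, a i ≠ a j := by
  by_contra hcon
  push Not at hcon
  obtain ⟨hb, hconst⟩ := hcon
  -- `a` is constant: either `0` (then `v = 0`) or `𝟙` (then `M v ≠ 0`)
  rcases isEmpty_or_nonempty (Fin k) with hk | ⟨⟨i₀⟩⟩
  · exact hne (funext fun x => by rcases x with ⟨i⟩ | ⟨i⟩ <;> exact (IsEmpty.false i).elim)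
  · have hval : ∀ z : ZMod 2, z = 0 ∨ z = 1 := by decide
    rcases hval (a i₀) with h0 | h1
    · apply hne
      have ha : a = 0 := funext fun j => (hconst j i₀).trans h0
      rw [ha, hb]
      funext x; cases x <;> rfl
    · have ha : a = fun _ => (1 : ZMod 2) := funext fun j => (hconst j i₀).trans h1
      rw [ha, hb] at hker
      exact monskyMatrixOdd_mulVec_one_zero_ne_zero p hp hp2 h5 hker

end Summit.BirchSwinnertonDyer.PrintCf2.MonskyRedeiForm
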